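import Summits.ValiantsHypothesis.ValiantsHypothesis.Theorems.PolyaContinuedSignedCoverLittleEarD
import Summits.ValiantsHypothesis.ValiantsHypothesis.Theorems.PolyaContinuedSignedCoverLittleEven
import HarnessLib

/-!
# Route PolyaContinued — support item `SignedCoverLittle` (stmt-ValiantsHypothesis-7426):
# (EAR) ⟶ (EVEN): three forks force non-Pfaffian-ness

Glue between `…EarD.lean` (`ear_caseB`, the Case-B structure of two dicircuits `μ, ν` with three
forks) and `…Even.lean` (`not_isPfaffianBipartite_of_caseB`, the certificate read off a Case-B
structure), steps (EAR)+(EVEN) of the paper proof `proof-LabelTransfer.md`, §2: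

* `ear_caseB_fin` — `ear_caseB` repackaged with the forks and single-ear circuits indexed by
  `Fin 3` (`p (j+1)` = the next fork along `μ`), in the hypothesis shapes of
  `countP_caseB` / `not_isPfaffianBipartite_of_caseB` (including the disjointness of the spliced
  paths and the `∃!`-form of the two partitions);
* `not_isPfaffianBipartite_of_three_le_forks` — **if `G ⊇ diagonal` carries two cyclic
  permutations `μ, ν` with at least three forks, and the cyclic permutations moving every point
  as `μ`, as `ν` or not at all are among at most five permutations `S ∋ μ, ν` inside `G`, any two
  of which differ by a single cycle, then `G` is not Pfaffian.** In the closer: `G = H₁` (normal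
  form), `μ, ν = γ₊, γ₋`, `S` = the five non-identity perfect matchings of `H₁`
  (`…TransferCircuits.lean`), `3 ≤ #forks` from `card_forks_le_of_labelExponent_eq`
  (`…Count.lean`) and the target's identity (T).
-/

namespace Summit.ValiantsHypothesis.PolyaContinued

open Equiv Equiv.Perm Finset Literature.Combinatorics.SimpleGraph

section Fin3

variable {α : Type*} [Fintype α] [DecidableEq α]

/-- `∀ j : Fin 3` from the three instances. [folklore] -/
private theorem forall_fin_three {P : Fin 3 → Prop} (h0 : P 0) (h1 : P 1) (h2 : P 2) :
    ∀ j, P j := by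
  intro j
  rcases j with ⟨_ | _ | _ | k, hk⟩
  · exact h0
  · exact h1
  · exact h2
  · exact absurd hk (by omega)

omit [Fintype α] [DecidableEq α] in
/-- `∃! j : Fin 3` from a covering by three pairwise disjoint finsets. [folklore] -/
private theorem existsUnique_fin_three (A : Fin 3 → Finset α) {v : α}
    (hcov : v ∈ A 0 ∨ v ∈ A 1 ∨ v ∈ A 2) (h01 : Disjoint (A 0) (A 1))
    (h12 : Disjoint (A 1) (A 2)) (h20 : Disjoint (A 2) (A 0)) : ∃! j, v ∈ A j := by
  have key : ∀ j j', v ∈ A j → v ∈ A j' → j = j' := by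
    refine forall_fin_three (forall_fin_three ?_ ?_ ?_) (forall_fin_three ?_ ?_ ?_)
      (forall_fin_three ?_ ?_ ?_)
    · exact fun _ _ => rfl
    · exact fun h h' => absurd h' (Finset.disjoint_left.1 h01 h)
    · exact fun h h' => absurd h (Finset.disjoint_left.1 h20 h')
    · exact fun h h' => absurd h (Finset.disjoint_left.1 h01 h')
    · exact fun _ _ => rfl
    · exact fun h h' => absurd h' (Finset.disjoint_left.1 h12 h)
    · exact fun h h' => absurd h' (Finset.disjoint_left.1 h20 h)
    · exact fun h h' => absurd h (Finset.disjoint_left.1 h12 h')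
    · exact fun _ _ => rfl
  rcases hcov with h | h | h
  · exact ⟨0, h, fun j hj => key j 0 hj h⟩
  · exact ⟨1, h, fun j hj => key j 1 hj h⟩
  · exact ⟨2, h, fun j hj => key j 2 hj h⟩

/-- **Case B, `Fin 3`-indexed.** `ear_caseB` with the three forks `p 0 → p 1 → p 2` (cyclic order
along `μ`; `ν` meets them in the order `p 0 → p 2 → p 1`) and the three single-ear circuits `Z j`
(following `μ` on the `μ`-path from `p j` to `p (j+1)`, `ν` on the `ν`-path from `p (j+1)` back to
`p j`, the two paths disjoint, fixing everything else), the `μ`-paths partitioning `supp μ` and the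
`ν`-paths partitioning `supp ν` — in the hypothesis shapes of `not_isPfaffianBipartite_of_caseB`.
[folklore] -/
theorem ear_caseB_fin {μ ν : Perm α} (hμ : μ.IsCycle) (hν : ν.IsCycle)
    (S : Finset (Perm α)) (hS5 : S.card ≤ 5) (hμS : μ ∈ S) (hνS : ν ∈ S)
    (hS : ∀ c : Perm α, c.IsCycle → (∀ v, c v = μ v ∨ c v = ν v ∨ c v = v) → c ∈ S)
    (hcyc : ∀ c ∈ S, ∀ c' ∈ S, c ≠ c' → (c⁻¹ * c').IsCycle)
    (h3 : 3 ≤ (forks μ ν).card) :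
    ∃ (p : Fin 3 → α) (Z : Fin 3 → Perm α),
      (∀ j, p j ∈ forks μ ν) ∧ Function.Injective p ∧
      (p 1 ∈ pathSet μ (p 0) (p 2) ∧ p 2 ∈ pathSet ν (p 0) (p 1)) ∧
      (∀ j, (Z j).IsCycle) ∧ (∀ j, Z j ∈ S) ∧ (∀ j, Z j ≠ μ ∧ Z j ≠ ν) ∧ Function.Injective Z ∧
      (∀ j v, v ∈ pathSet μ (p j) (p (j + 1)) → Z j v = μ v) ∧
      (∀ j v, v ∈ pathSet ν (p (j + 1)) (p j) → Z j v = ν v) ∧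
      (∀ j v, v ∉ pathSet μ (p j) (p (j + 1)) → v ∉ pathSet ν (p (j + 1)) (p j) → Z j v = v) ∧
      (∀ j, (Z j).support = pathSet μ (p j) (p (j + 1)) ∪ pathSet ν (p (j + 1)) (p j)) ∧
      (∀ j, Disjoint (pathSet μ (p j) (p (j + 1))) (pathSet ν (p (j + 1)) (p j))) ∧
      (∀ v ∈ μ.support, ∃! j, v ∈ pathSet μ (p j) (p (j + 1))) ∧
      (∀ v ∈ ν.support, ∃! j, v ∈ pathSet ν (p (j + 1)) (p j)) ∧
      (∀ j v, Z j v = μ v ∨ Z j v = ν v ∨ Z j v = v) := by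
  classical
  obtain ⟨p₀, p₁, p₂, Z₀, Z₁, Z₂, ⟨hF, h01, h12, h02⟩, ⟨hordμ, hordν⟩,
    ⟨hZ₀c, hZ₀S, hZ₀μ, hZ₀ν, h0₁, h0₂, h0₃, h0₄⟩, ⟨hZ₁c, hZ₁S, hZ₁μ, hZ₁ν, h1₁, h1₂, h1₃, h1₄⟩,
    ⟨hZ₂c, hZ₂S, hZ₂μ, hZ₂ν, h2₁, h2₂, h2₃, h2₄⟩, ⟨hZ₀₁, hZ₁₂, hZ₂₀⟩,
    ⟨hμcov, hμd01, hμd12, hμd20⟩, ⟨hνcov, hνd01, hνd12, hνd20⟩⟩ :=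
    ear_caseB hμ hν S hS5 hμS hνS hS hcyc h3
  have hp₀ : p₀ ∈ forks μ ν := by rw [hF]; simp
  have hp₁ : p₁ ∈ forks μ ν := by rw [hF]; simp
  have hp₂ : p₂ ∈ forks μ ν := by rw [hF]; simp
  have hp₀μ := mem_support_of_mem_forks_left hp₀
  have hp₁μ := mem_support_of_mem_forks_left hp₁
  have hp₂μ := mem_support_of_mem_forks_left hp₂
  have hmemF : ∀ x ∈ forks μ ν, x = p₀ ∨ x = p₁ ∨ x = p₂ := by
    intro x hx; rw [hF] at hx; simpa using hx
  have hordlt := (mem_pathSet.1 hordμ).2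
  -- no fork strictly inside the three `μ`-arcs (for the disjointness of the spliced paths)
  have hno₀ : ∀ x ∈ forks μ ν, x ∈ pathSet μ p₀ p₁ → x = p₀ := by
    intro x hx hxm
    rcases hmemF x hx with rfl | rfl | rfl
    · rfl
    · exact absurd hxm (notMem_pathSet_end μ p₀ x)
    · have := (mem_pathSet.1 hxm).2; omega
  have hno₁ : ∀ x ∈ forks μ ν, x ∈ pathSet μ p₁ p₂ → x = p₁ := by
    intro x hx hxm
    rcases hmemF x hx with rfl | rfl | rfl
    · have := (mem_pathSet_iff_le_and_lt hμ hp₀μ hp₁μ hp₂μ hp₀μ hordμ).1 hxm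
      rw [cdist_self] at this
      have h0 : cdist μ x p₁ = 0 := by omega
      exact absurd ((cdist_eq_zero_iff hμ hp₀μ hp₁μ).1 h0) h01.symm
    · rfl
    · exact absurd hxm (notMem_pathSet_end μ p₁ x)
  have hno₂ : ∀ x ∈ forks μ ν, x ∈ pathSet μ p₂ p₀ → x = p₂ := by
    intro x hx hxm
    rcases hmemF x hx with rfl | rfl | rfl
    · exact absurd hxm (notMem_pathSet_end μ p₂ x)
    · have := (mem_pathSet_iff_le hμ hp₀μ hp₂μ hp₁μ h02).1 hxm; omega
    · rfl
  have hd₀ := disjoint_pathSet_of_forks hμ hν hp₀ hp₁ hno₀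
  have hd₁ := disjoint_pathSet_of_forks hμ hν hp₁ hp₂ hno₁
  have hd₂ := disjoint_pathSet_of_forks hμ hν hp₂ hp₀ hno₂
  refine ⟨![p₀, p₁, p₂], ![Z₀, Z₁, Z₂], forall_fin_three hp₀ hp₁ hp₂, ?_,
    ⟨hordμ, hordν⟩, forall_fin_three hZ₀c hZ₁c hZ₂c, forall_fin_three hZ₀S hZ₁S hZ₂S,
    forall_fin_three ⟨hZ₀μ, hZ₀ν⟩ ⟨hZ₁μ, hZ₁ν⟩ ⟨hZ₂μ, hZ₂ν⟩, ?_,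
    forall_fin_three h0₁ h1₁ h2₁, forall_fin_three h0₂ h1₂ h2₂, forall_fin_three h0₃ h1₃ h2₃,
    forall_fin_three h0₄ h1₄ h2₄, forall_fin_three hd₀ hd₁ hd₂, fun v hv => ?_, fun v hv => ?_,
    forall_fin_three (ear_apply_or h0₁ h0₂ h0₃) (ear_apply_or h1₁ h1₂ h1₃)
      (ear_apply_or h2₁ h2₂ h2₃)⟩
  · -- `p` injective
    intro j j' h
    revert h
    refine forall_fin_three (P := fun j => ∀ j' : Fin 3,
      (![p₀, p₁, p₂] : Fin 3 → α) j = ![p₀, p₁, p₂] j' → j = j') ?_ ?_ ?_ j j' <;>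
      refine forall_fin_three ?_ ?_ ?_
    · exact fun _ => rfl
    · exact fun h => absurd h h01
    · exact fun h => absurd h h02
    · exact fun h => absurd h.symm h01
    · exact fun _ => rfl
    · exact fun h => absurd h h12
    · exact fun h => absurd h.symm h02
    · exact fun h => absurd h.symm h12
    · exact fun _ => rfl
  · -- `Z` injective
    intro j j' h
    revert h
    refine forall_fin_three (P := fun j => ∀ j' : Fin 3,
      (![Z₀, Z₁, Z₂] : Fin 3 → Perm α) j = ![Z₀, Z₁, Z₂] j' → j = j') ?_ ?_ ?_ j j' <;>
      refine forall_fin_three ?_ ?_ ?_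
    · exact fun _ => rfl
    · exact fun h => absurd h hZ₀₁
    · exact fun h => absurd h.symm hZ₂₀
    · exact fun h => absurd h.symm hZ₀₁
    · exact fun _ => rfl
    · exact fun h => absurd h hZ₁₂
    · exact fun h => absurd h hZ₂₀
    · exact fun h => absurd h.symm hZ₁₂
    · exact fun _ => rfl
  · exact existsUnique_fin_three (fun j => pathSet μ ((![p₀, p₁, p₂] : Fin 3 → α) j)
      ((![p₀, p₁, p₂] : Fin 3 → α) (j + 1))) (hμcov v hv) hμd01 hμd12 hμd20
  · exact existsUnique_fin_three (fun j => pathSet ν ((![p₀, p₁, p₂] : Fin 3 → α) (j + 1))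
      ((![p₀, p₁, p₂] : Fin 3 → α) j)) (hνcov v hv) hνd01 hνd12 hνd20

end Fin3

/-! ### Conclusion -/

variable {n : ℕ}

/-- **Three forks force non-Pfaffian-ness.** Let `G ⊆ Fin n × Fin n` contain the diagonal and two
cyclic permutations `μ, ν` (directed circuits of `D(G, M)`) with at least three forks; suppose
the cyclic permutations moving each point as `μ`, as `ν` or not at all lie in a finset `S ∋ μ, ν`
of at most five permutations inside `G`, any two of which differ by a single cycle. Then `G` is
not Pfaffian: by `ear_caseB` the two circuits and their three single-ear circuits form a Case-B
configuration, whose five circuits cover every off-diagonal cell an even number of times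
(`not_isPfaffianBipartite_of_caseB`). Steps (EAR)+(EVEN) of the paper proof; in the closer
`G = H₁`, `μ, ν = γ₊, γ₋`, `S` = the non-identity perfect matchings of `H₁`. [folklore] -/
theorem not_isPfaffianBipartite_of_three_le_forks {G : Finset (Fin n × Fin n)}
    (hdiag : ∀ i, (i, i) ∈ G) {μ ν : Perm (Fin n)} (hμ : μ.IsCycle) (hν : ν.IsCycle)
    (hμG : ∀ i, (i, μ i) ∈ G) (hνG : ∀ i, (i, ν i) ∈ G)
    (S : Finset (Perm (Fin n))) (hS5 : S.card ≤ 5) (hμS : μ ∈ S) (hνS : ν ∈ S)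
    (hS : ∀ c : Perm (Fin n), c.IsCycle → (∀ v, c v = μ v ∨ c v = ν v ∨ c v = v) → c ∈ S)
    (hcyc : ∀ c ∈ S, ∀ c' ∈ S, c ≠ c' → (c⁻¹ * c').IsCycle)
    (h3 : 3 ≤ (forks μ ν).card) : ¬ IsPfaffianBipartite G := by
  obtain ⟨p, Z, -, -, -, hZc, -, -, -, hZμ, hZν, hZfix, -, hdisj, hμpart, hνpart, hZor⟩ :=
    ear_caseB_fin hμ hν S hS5 hμS hνS hS hcyc h3
  have hZG : ∀ j i, (i, Z j i) ∈ G := by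
    intro j i
    rcases hZor j i with h | h | h
    · rw [h]; exact hμG i
    · rw [h]; exact hνG i
    · rw [h]; exact hdiag i
  exact not_isPfaffianBipartite_of_caseB hdiag hμ hν hμG hνG p Z hZc hZG hZμ hZν hZfix hdisj
    hμpart hνpart

end Summit.ValiantsHypothesis.PolyaContinued
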